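import Summits.Ventures.CertifiedQuantumChemistry.Rows.ResidualScreenPSD
import Summits.Ventures.CertifiedQuantumChemistry.Rows.ExactLDLRank
import HarnessLib

/-!
# Ventures/CertifiedQuantumChemistry — Rows/ResidualScreenRank.lean: A≡B at the level of ranks — the
# residual screen's kept count IS the rank the checker of record prints

HONEST FRAMING (verbatim): certified bounds for a stated model Hamiltonian in a stated basis; not a
claim about the real molecule beyond that model.

Seat rdm-B (gen 34), zero compute; a small companion of `Rows/ResidualScreenPSD.lean` (no row, no claim
node, nothing of record moves). The record checker `code/qchem_rdm_b/check_enclosure.py` prints, for every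
block, the count of accepted positive pivots of its pivoting-free exact `LDLᵀ` — typed as `ExactLDL.ldlRank`
with `ldlRank n M = M.rank` on PSD input (`Rows/ExactLDLRank.lean`). When a δ-shifted residual screen
(`ResidualScreen.kernel_exact_of_certZ_shift`: exact structural kernel `W`, invertible dropped rows,
integer Gram / Gershgorin certificate for `c • (M[S,S] − δ·1)`) succeeds on the same block, the two
verification lanes agree on the rank words BY THEOREM, not by comparing transcripts:

* `ResidualScreen.ldlRank_eq_kept_of_certZ_shift` — printed rank `= k` (the kept count) and printed
  structural-kernel count `n − rank = |T|` (the dropped count);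
* `ResidualScreen.ldlRank_eq_kept_of_posDef_kept` — the same conclusion from positive definiteness of the
  kept block obtained by any means.

Everything is PROVED (0 sorry); [folklore] (rank–nullity; facial reduction by a known kernel).
-/

namespace Summit.Ventures.CertifiedQuantumChemistry

namespace ResidualScreen

open Matrix Module Literature.Computation.Certificates

section RankWords

variable {K : Type*} [Field K] [LinearOrder K] [IsStrictOrderedRing K] [StarRing K] [TrivialStar K]
variable {T : Type*} [Fintype T] [DecidableEq T] {n k r : ℕ}

/-- **PRINTED RANK = KEPT COUNT.** For a Hermitian block `M` of dimension `n` with exact structural kernel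
`W` (`M * W = 0`), a splitting `e : Fin k ⊕ T ≃ Fin n` with invertible dropped rows, and a δ-shifted integer
certificate (`IsGramCertZ A d F`, `A = c • (M[S,S] − δ·1)`, `0 < c`, `0 < δ`): the checker of record's
printed rank `ldlRank n M` equals `k`, and its structural-kernel count `n − ldlRank n M` equals `|T|`.
[folklore] -/
theorem ldlRank_eq_kept_of_certZ_shift {M : Matrix (Fin n) (Fin n) K} (hM : M.IsHermitian)
    {W : Matrix (Fin n) T K} (hMW : M * W = 0) (e : Fin k ⊕ T ≃ Fin n)
    [Invertible (W.submatrix e id).toRows₂]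
    {A : Matrix (Fin k) (Fin k) ℤ} {d : Fin r → ℕ} {F : Matrix (Fin r) (Fin k) ℤ}
    (hcert : PSD.IsGramCertZ A d F) {c δ : K} (hc : 0 < c) (hδ : 0 < δ)
    (hA : ∀ i j, ((A i j : ℤ) : K) =
      c * (M.submatrix (e ∘ Sum.inl) (e ∘ Sum.inl) - δ • (1 : Matrix (Fin k) (Fin k) K)) i j) :
    ExactLDL.ldlRank n M = k ∧ n - ExactLDL.ldlRank n M = Fintype.card T := by
  obtain ⟨hpsd, -, hker, hrank⟩ := kernel_exact_of_certZ_shift hM hMW e hcert hc hδ hA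
  have h1 : ExactLDL.ldlRank n M = k := by rw [ExactLDL.ldlRank_eq_rank n M hpsd, hrank]
  refine ⟨h1, ?_⟩
  rw [← ExactLDL.finrank_ker_eq_sub_ldlRank M hpsd, hker]

/-- The same words WITHOUT a shift, read the other way: whenever the kept block is known to be positive
definite (by any means) the printed rank is the kept count — e.g. the twin's summed isotypic ranks
(`Rows/CommutingCoverRank.lean`) and the plain count agree with `|S|`. [folklore] -/
theorem ldlRank_eq_kept_of_posDef_kept {S : Type*} [Fintype S] {M : Matrix (Fin n) (Fin n) K}
    (hM : M.IsHermitian) {W : Matrix (Fin n) T K} (hMW : M * W = 0) (e : S ⊕ T ≃ Fin n)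
    [Invertible (W.submatrix e id).toRows₂] (hpos : (M.submatrix (e ∘ Sum.inl) (e ∘ Sum.inl)).PosDef) :
    ExactLDL.ldlRank n M = Fintype.card S := by
  have hpsd : M.PosSemidef := (posSemidef_iff_submatrix_of_mul_eq_zero hM hMW e).mpr hpos.posSemidef
  rw [ExactLDL.ldlRank_eq_rank n M hpsd, rank_eq_card_kept hMW e hpos]

end RankWords

end ResidualScreen

end Summit.Ventures.CertifiedQuantumChemistry
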